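import Summits.RiemannHypothesis.RiemannHypothesis.Theorems.SoloInformedGroundStateZeroSide
import Literature.NumberTheory.LFunctions.ZetaZeroFreeRegion
import Literature.NumberTheory.LFunctions.ConnesProlateGuessTail
import Literature.NumberTheory.LFunctions.WeilExplicitContinuous
import HarnessLib

/-!
# M2 upper half (1/7): the exponent-explicit upper law, sharp window counting, the zeros' abscissae

pub-rhpf cell (M2 seat, generation 3) — part 1 of 7 of the M2 UPPER-HALF packet.  HONEST FRAMING:
long-odds MECHANISM SEARCH; no RH claims.  Everything in this file is PROVED (kernel-checked, RH-free) or an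
explicitly named `def … : Prop` taken as an argument; nothing here implies or assumes RH.  The packet's
headline and full ledger are in `PfPersistenceM2UpperLeak.lean` (part 7):
`ProlateLeakL1 A p Λ` (ONE RH-free prolate leak bound, exponent `p`) + two named literature facts
⇒ `ConnesLawUpperWitnessWith (2p + 1 + δ)` ⇒ `ConnesLawUpperWith (2p + 1 + δ)` ⇒ `ConnesLawUpper`.

This part (PROVED):
* §A `ConnesLawUpperWith B` — `ε(a) ≤ C μ^B e^{-4πμ}` for `a ≥ 1` (`μ = e^{2a}`), `→ ConnesLawUpper`
  (`connesLawUpper_of_with`); its WITNESS form `ConnesLawUpperWitnessWith B` (eventually a normalised window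
  test with Weil energy `≤ C μ^B e^{-4πμ}` — the shape of the hypotheses `hp`, `hU` of
  `PfPersistenceM2Laws.m2_asymptotic_of_three_laws`) with the normalisation lemma
  `connesLawUpperWitnessWith_of_rayleigh`; exponent-keeping copies of the tree's reductions
  (`connesLawUpperWith_of_explicit`, `connesLawUpperWith_of_zeroSums`).
* §B SHARP COUNTING `exists_windowCount`: for every weight `w : ℕ → ℝ≥0` and every finite set `F` of
  non-trivial zeros, `Σ_{ρ∈F} m(ρ) w(j(ρ)) ≤ C Σ_{j<N} log(j+2) w(j)` with `j(ρ) = |round γ|` (`windowIndex`)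
  and ONE absolute `C` (Jensen window count `exists_sum_zetaZeroWindow_le` + the reflection `ρ ↦ 1 − ρ̄`);
  hence `connesLawUpperWith_of_windowBound`.  The tree's `connesLawUpper_of_pointwise` charges every zero the
  weight `(1+γ²)^{-2}`, which for a mollifier of radius `η` costs `η^{-4}`; the window count costs `η^{-1-ε}`.
* §C `exists_div_log_le_re`: `∃ c₀ > 0`, `c₀/log(|γ|+4) ≤ Re ρ` and `≤ 1 − Re ρ` at every non-trivial zero
  (de la Vallée-Poussin region `classicalZFRData_riemannZeta.zeroFree` of the tree + reflection).

References: A. Connes, letter (2026) §6; the tree files cited by name (their `[cite: …]` tags carry the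
classical sources).
-/

noncomputable section

set_option linter.dupNamespace false  -- the mandated namespace repeats `RiemannHypothesis`

open Complex Filter Set Topology Metric MeasureTheory
open Literature.NumberTheory.LFunctions
open scoped ComplexConjugate Convolution

namespace Summit.RiemannHypothesis.RiemannHypothesis.Theorems.PfPersistenceM2Leak

/-! ## §A The exponent-explicit upper law -/

/-- **Upper law with exponent `B`**: `∃ C, ∀ a ≥ 1, ε(a) ≤ C · μ^B · e^{-4πμ}`, `μ = e^{2a}`.
(`ConnesLawUpper` of the tree is `∃ B, ConnesLawUpperWith B`.) -/
@[conjecture] def ConnesLawUpperWith (B : ℝ) : Prop :=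
  ∃ C : ℝ, ∀ a : ℝ, 1 ≤ a →
    weilGroundEnergy a ≤ C * Real.exp (2 * a) ^ B * Real.exp (-(4 * Real.pi * Real.exp (2 * a)))

/-- The exponent-explicit law implies the tree's `ConnesLawUpper`. -/
theorem connesLawUpper_of_with {B : ℝ} (h : ConnesLawUpperWith B) : ConnesLawUpper := by
  obtain ⟨C, hC⟩ := h
  exact ⟨C, B, hC⟩

/-- `ConnesLawUpper ↔ ∃ B, ConnesLawUpperWith B`. -/
theorem connesLawUpper_iff_exists_with : ConnesLawUpper ↔ ∃ B : ℝ, ConnesLawUpperWith B :=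
  ⟨fun ⟨C, B, h⟩ ↦ ⟨B, C, h⟩, fun ⟨_, h⟩ ↦ connesLawUpper_of_with h⟩

/-- Monotonicity in the exponent: `μ ≥ 1`, so a law with exponent `B` gives one with any `B' ≥ B`
(for `C ≥ 0`; a law with `C < 0` is upgraded to `C = 0` first). -/
theorem ConnesLawUpperWith.mono {B B' : ℝ} (h : ConnesLawUpperWith B) (hBB' : B ≤ B') :
    ConnesLawUpperWith B' := by
  obtain ⟨C, hC⟩ := h
  refine ⟨max C 0, fun a ha ↦ (hC a ha).trans ?_⟩
  have hμ : 1 ≤ Real.exp (2 * a) := Real.one_le_exp (by linarith)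
  have h1 : Real.exp (2 * a) ^ B ≤ Real.exp (2 * a) ^ B' := Real.rpow_le_rpow_of_exponent_le hμ hBB'
  have h2 : 0 ≤ Real.exp (2 * a) ^ B := Real.rpow_nonneg (Real.exp_pos _).le _
  have h3 : 0 < Real.exp (-(4 * Real.pi * Real.exp (2 * a))) := Real.exp_pos _
  calc C * Real.exp (2 * a) ^ B * Real.exp (-(4 * Real.pi * Real.exp (2 * a)))
      ≤ max C 0 * Real.exp (2 * a) ^ B * Real.exp (-(4 * Real.pi * Real.exp (2 * a))) :=
        mul_le_mul_of_nonneg_right (mul_le_mul_of_nonneg_right (le_max_left _ _) h2) h3.le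
    _ ≤ max C 0 * Real.exp (2 * a) ^ B' * Real.exp (-(4 * Real.pi * Real.exp (2 * a))) :=
        mul_le_mul_of_nonneg_right (mul_le_mul_of_nonneg_left h1 (le_max_right _ _)) h3.le

/-- **Upper law in WITNESS form, exponent `B`** — the shape consumed by
`PfPersistenceM2Laws.m2_asymptotic_of_three_laws` (its hypotheses `hp`, `hU`, with `B = B_U`): eventually in
`a`, a NORMALISED Weil test function supported in the window `[-a, a]` whose Weil energy is
`≤ C μ^B e^{-4πμ}`.  Implies `ConnesLawUpperWith B` (`connesLawUpperWith_of_witnessWith`). -/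
@[conjecture] def ConnesLawUpperWitnessWith (B : ℝ) : Prop :=
  ∃ C a₀ : ℝ, ∃ q : ℝ → ℝ → ℂ, ∀ a : ℝ, a₀ ≤ a →
    (IsWeilTest (q a) ∧ tsupport (q a) ⊆ Icc (-a) a ∧ ∫ t : ℝ, ‖q a t‖ ^ 2 = (1 : ℝ)) ∧
    (weilQuadratic (q a)).re ≤ C * Real.exp (2 * a) ^ B * Real.exp (-(4 * Real.pi * Real.exp (2 * a)))

/-- Normalisation: an eventual family of window tests with `‖k‖₂ > 0` and
`Re W(k) ≤ C μ^B e^{-4πμ} ‖k‖₂²` gives the witness form (`k/‖k‖₂`; `Q(c g) = |c|² Q(g)`,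
`weilQuadratic_const_mul`). -/
theorem connesLawUpperWitnessWith_of_rayleigh {B C a₀ : ℝ}
    (h : ∀ a : ℝ, a₀ ≤ a → ∃ k : ℝ → ℂ, IsWeilTest k ∧ tsupport k ⊆ Icc (-a) a ∧
      0 < ∫ t : ℝ, ‖k t‖ ^ 2 ∧ (weilQuadratic k).re ≤
        C * Real.exp (2 * a) ^ B * Real.exp (-(4 * Real.pi * Real.exp (2 * a))) * ∫ t : ℝ, ‖k t‖ ^ 2) :
    ConnesLawUpperWitnessWith B := by
  choose! k hk using h
  refine ⟨C, a₀, fun a t ↦ (((Real.sqrt (∫ s : ℝ, ‖k a s‖ ^ 2))⁻¹ : ℝ) : ℂ) * k a t, fun a ha ↦ ?_⟩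
  obtain ⟨hkt, hks, hpos, hW⟩ := hk a ha
  obtain ⟨N2, hN2⟩ : ∃ N2 : ℝ, N2 = ∫ s : ℝ, ‖k a s‖ ^ 2 := ⟨_, rfl⟩
  rw [← hN2] at hpos hW
  obtain ⟨c, hc⟩ : ∃ c : ℝ, c = (Real.sqrt N2)⁻¹ := ⟨_, rfl⟩
  have hcpos : 0 < c := hc ▸ inv_pos.2 (Real.sqrt_pos.2 hpos)
  have hcc : c * c * N2 = 1 := by
    rw [hc, ← mul_inv, Real.mul_self_sqrt hpos.le, inv_mul_cancel₀ hpos.ne']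
  dsimp only
  rw [← hN2, ← hc]
  refine ⟨⟨hkt.const_mul c, tsupport_mul_subset_right.trans hks, ?_⟩, ?_⟩
  · simp only [norm_mul, mul_pow, Complex.norm_real, Real.norm_of_nonneg hcpos.le]
    rw [integral_const_mul, ← hN2, sq, hcc]
  · rw [weilQuadratic_const_mul, Complex.normSq_ofReal, Complex.re_ofReal_mul]
    calc c * c * (weilQuadratic (k a)).re
        ≤ c * c * (C * Real.exp (2 * a) ^ B * Real.exp (-(4 * Real.pi * Real.exp (2 * a))) * N2) :=
          mul_le_mul_of_nonneg_left hW (mul_self_nonneg c)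
      _ = C * Real.exp (2 * a) ^ B * Real.exp (-(4 * Real.pi * Real.exp (2 * a))) * (c * c * N2) := by
          ring
      _ = C * Real.exp (2 * a) ^ B * Real.exp (-(4 * Real.pi * Real.exp (2 * a))) := by
          rw [hcc, mul_one]

/-- Exponent-keeping copy of `connesLawUpper_of_explicit`: one family of window test functions whose
Rayleigh quotients obey the law with exponent `B` gives `ConnesLawUpperWith B` (`weilGroundEnergy_le_div`). -/
theorem connesLawUpperWith_of_explicit {C B : ℝ}
    (h : ∀ a : ℝ, 1 ≤ a → ∃ k : ℝ → ℂ, IsWeilTest k ∧ tsupport k ⊆ Icc (-a) a ∧ 0 < ∫ t : ℝ, ‖k t‖ ^ 2 ∧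
      (weilQuadratic k).re ≤
        C * Real.exp (2 * a) ^ B * Real.exp (-(4 * Real.pi * Real.exp (2 * a))) * ∫ t : ℝ, ‖k t‖ ^ 2) :
    ConnesLawUpperWith B := by
  refine ⟨C, fun a ha ↦ ?_⟩
  obtain ⟨k, hk, hs, hpos, hQ⟩ := h a ha
  exact (weilGroundEnergy_le_div hk hs hpos).trans ((div_le_iff₀ hpos).2 hQ)

/-- Exponent-keeping copy of `connesLawUpper_of_zeroSums` (explicit formula + Bessel pairing,
`re_weilQuadratic_le_of_zeroSum_le`). -/
theorem connesLawUpperWith_of_zeroSums {C B : ℝ}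
    (h : ∀ a : ℝ, 1 ≤ a → ∃ k : ℝ → ℂ, IsWeilTest k ∧ tsupport k ⊆ Icc (-a) a ∧ 0 < ∫ t : ℝ, ‖k t‖ ^ 2 ∧
      ∀ T : ℝ, ∑ᶠ ρ ∈ weilZeroIndex T, (riemannZetaZeroOrder ρ : ℝ) * ‖weilMellin k ρ‖ ^ 2 ≤
        C * Real.exp (2 * a) ^ B * Real.exp (-(4 * Real.pi * Real.exp (2 * a))) * ∫ t : ℝ, ‖k t‖ ^ 2) :
    ConnesLawUpperWith B :=
  connesLawUpperWith_of_explicit fun a ha ↦ by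
    obtain ⟨k, hk, hs, hpos, hT⟩ := h a ha
    exact ⟨k, hk, hs, hpos, re_weilQuadratic_le_of_zeroSum_le hk hT⟩

/-! ## §B Sharp counting: window-indexed weights -/

/-- The window index is invariant under the reflection `ρ ↦ 1 − ρ̄`. -/
theorem windowIndex_one_sub_conj (ρ : ℂ) : windowIndex (1 - conj ρ) = windowIndex ρ := by
  simp [windowIndex]

/-- Window count for zeros to the right of `σ = 1/4`: with `C` the constant of the tree's
`exists_sum_zetaZeroWindow_le`-hypothesis, `Σ_{ρ ∈ G} m(ρ) w(j(ρ)) ≤ 2C Σ_{j ≤ sup j} log(j+2) w(j)`. -/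
theorem sum_zetaZerosRight_mul_le {C : ℝ}
    (hC : ∀ τ : ℝ, ∑ ρ ∈ (zetaZeroWindow_finite τ).toFinset, (riemannZetaZeroOrder ρ : ℝ) ≤
      C * Real.log (|τ| + 2))
    {w : ℕ → ℝ} (hw : ∀ j, 0 ≤ w j) (G : Finset ℂ) (hG : ∀ ρ ∈ G, ρ ∈ zetaZerosRight) :
    ∑ ρ ∈ G, (riemannZetaZeroOrder ρ : ℝ) * w (windowIndex ρ) ≤
      2 * C * ∑ j ∈ Finset.range (G.sup windowIndex + 1), Real.log ((j : ℝ) + 2) * w j := by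
  set N : ℕ := G.sup windowIndex + 1 with hN
  have hmaps : ∀ ρ ∈ G, windowIndex ρ ∈ Finset.range N := fun ρ hρ ↦ by
    rw [Finset.mem_range, hN]
    exact Nat.lt_succ_of_le (Finset.le_sup hρ)
  rw [← Finset.sum_fiberwise_of_maps_to hmaps, Finset.mul_sum]
  refine Finset.sum_le_sum fun j _ ↦ ?_
  have hsub : ∀ ρ ∈ G.filter (fun ρ ↦ windowIndex ρ = j), ρ ∈ zetaZeroWindowPair j := by
    intro ρ hρ
    rw [Finset.mem_filter] at hρ
    rw [← hρ.2]
    exact mem_zetaZeroWindowPair_windowIndex (hG ρ hρ.1)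
  calc ∑ ρ ∈ G with windowIndex ρ = j, (riemannZetaZeroOrder ρ : ℝ) * w (windowIndex ρ)
      = ∑ ρ ∈ G with windowIndex ρ = j, (riemannZetaZeroOrder ρ : ℝ) * w j := by
        refine Finset.sum_congr rfl fun ρ hρ ↦ ?_
        rw [(Finset.mem_filter.1 hρ).2]
    _ = (∑ ρ ∈ G with windowIndex ρ = j, (riemannZetaZeroOrder ρ : ℝ)) * w j := by
        rw [Finset.sum_mul]
    _ ≤ (∑ ρ ∈ (zetaZeroWindowPair_finite j).toFinset, (riemannZetaZeroOrder ρ : ℝ)) * w j := by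
        refine mul_le_mul_of_nonneg_right ?_ (hw j)
        refine Finset.sum_le_sum_of_subset_of_nonneg (fun ρ hρ ↦ ?_) fun ρ hρ _ ↦ ?_
        · rw [Set.Finite.mem_toFinset]; exact hsub ρ hρ
        · rw [Set.Finite.mem_toFinset] at hρ
          rcases hρ with hρ | hρ <;> exact riemannZetaZeroOrder_nonneg_of_zero hρ.1
    _ ≤ (2 * C * Real.log ((j : ℝ) + 2)) * w j :=
        mul_le_mul_of_nonneg_right (sum_zetaZeroWindowPair_le hC j) (hw j)
    _ = 2 * C * (Real.log ((j : ℝ) + 2) * w j) := by ring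

/-- Partial sums of a non-negative sequence are monotone in the range. -/
theorem sum_range_mono_of_nonneg {f : ℕ → ℝ} (hf : ∀ j, 0 ≤ f j) {M N : ℕ} (h : M ≤ N) :
    ∑ j ∈ Finset.range M, f j ≤ ∑ j ∈ Finset.range N, f j :=
  Finset.sum_le_sum_of_subset_of_nonneg (Finset.range_mono h) fun j _ _ ↦ hf j

/-- **Sharp zero counting against a window-indexed weight** (PROVED, unconditional).  There is an absolute
`C > 0` such that for every non-negative `w : ℕ → ℝ` and every finite set `F` of non-trivial zeros,
`Σ_{ρ ∈ F} m(ρ) · w(j(ρ)) ≤ C · Σ_{j ≤ max_F j(ρ)} log(j + 2) · w(j)`, `j(ρ) = |round(Im ρ)|`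
(`windowIndex`).  Zeros with `Re ρ ≥ 1/4` are counted in the Jensen windows
(`exists_sum_zetaZeroWindow_le`: `N(T+1) − N(T) ≪ log(T+2)`, Montgomery–Vaughan Thm. 10.13); the others are
carried there by `ρ ↦ 1 − ρ̄`, which preserves ordinate, window index and multiplicity. -/
theorem exists_windowCount :
    ∃ C : ℝ, 0 < C ∧ ∀ (w : ℕ → ℝ), (∀ j, 0 ≤ w j) → ∀ F : Finset ℂ,
      (∀ ρ ∈ F, ρ ∈ ZetaZeros.riemannZetaNontrivialZeros) →
        ∑ ρ ∈ F, (riemannZetaZeroOrder ρ : ℝ) * w (windowIndex ρ) ≤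
          C * ∑ j ∈ Finset.range (F.sup windowIndex + 1), Real.log ((j : ℝ) + 2) * w j := by
  classical
  obtain ⟨C, hC0, hC⟩ := exists_sum_zetaZeroWindow_le
  refine ⟨4 * C, by positivity, fun w hw F hF ↦ ?_⟩
  set N : ℕ := F.sup windowIndex + 1 with hN
  have hterm : ∀ j : ℕ, 0 ≤ Real.log ((j : ℝ) + 2) * w j := fun j ↦
    mul_nonneg (Real.log_nonneg (by linarith [j.cast_nonneg (α := ℝ)])) (hw j)
  -- split by the abscissa
  set F₁ := F.filter (fun ρ ↦ 1 / 4 ≤ ρ.re) with hF₁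
  set F₂ := F.filter (fun ρ ↦ ¬ 1 / 4 ≤ ρ.re) with hF₂
  have hsplit : ∑ ρ ∈ F, (riemannZetaZeroOrder ρ : ℝ) * w (windowIndex ρ) =
      ∑ ρ ∈ F₁, (riemannZetaZeroOrder ρ : ℝ) * w (windowIndex ρ) +
        ∑ ρ ∈ F₂, (riemannZetaZeroOrder ρ : ℝ) * w (windowIndex ρ) :=
    (Finset.sum_filter_add_sum_filter_not F _ _).symm
  -- the right part
  have hG₁ : ∀ ρ ∈ F₁, ρ ∈ zetaZerosRight := fun ρ hρ ↦ by
    rw [hF₁, Finset.mem_filter] at hρ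
    exact ⟨ZetaZeros.riemannZetaNontrivialZeros.zeta_eq_zero (hF ρ hρ.1), hρ.2⟩
  have h₁ := sum_zetaZerosRight_mul_le hC hw F₁ hG₁
  have hsup₁ : F₁.sup windowIndex + 1 ≤ N := by
    rw [hN]
    exact Nat.succ_le_succ (Finset.sup_mono (Finset.filter_subset _ F))
  -- the left part, reflected
  set r : ℂ → ℂ := fun ρ ↦ 1 - conj ρ with hr
  have hrinj : Set.InjOn r F₂ := fun a _ b _ hab ↦ by
    have : conj a = conj b := sub_right_injective hab
    simpa using congrArg conj this
  set G₂ := F₂.image r with hG₂def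
  have hG₂ : ∀ ρ ∈ G₂, ρ ∈ zetaZerosRight := fun ρ hρ ↦ by
    rw [hG₂def, Finset.mem_image] at hρ
    obtain ⟨z, hz, rfl⟩ := hρ
    rw [hF₂, Finset.mem_filter] at hz
    have hz' := hF z hz.1
    refine ⟨ZetaZeros.riemannZetaNontrivialZeros.zeta_eq_zero
      (ZetaZeros.riemannZetaNontrivialZeros.one_sub_conj_mem hz'), ?_⟩
    simp only [hr, sub_re, one_re, conj_re]
    linarith [hz.2]
  have hsum₂ : ∑ ρ ∈ F₂, (riemannZetaZeroOrder ρ : ℝ) * w (windowIndex ρ) =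
      ∑ ρ ∈ G₂, (riemannZetaZeroOrder ρ : ℝ) * w (windowIndex ρ) := by
    rw [hG₂def, Finset.sum_image hrinj]
    refine Finset.sum_congr rfl fun ρ hρ ↦ ?_
    rw [hF₂, Finset.mem_filter] at hρ
    have hρ' := hF ρ hρ.1
    simp only [hr, windowIndex_one_sub_conj,
      riemannZetaZeroOrder_one_sub_conj (ZetaZeros.riemannZetaNontrivialZeros.re_pos hρ')
        (ZetaZeros.riemannZetaNontrivialZeros.re_lt_one hρ')]
  have h₂ := sum_zetaZerosRight_mul_le hC hw G₂ hG₂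
  have hsup₂ : G₂.sup windowIndex + 1 ≤ N := by
    rw [hN]
    refine Nat.succ_le_succ ?_
    refine Finset.sup_le fun ρ hρ ↦ ?_
    rw [hG₂def, Finset.mem_image] at hρ
    obtain ⟨z, hz, rfl⟩ := hρ
    rw [show windowIndex (r z) = windowIndex z from windowIndex_one_sub_conj z]
    exact Finset.le_sup (Finset.filter_subset _ F hz)
  have hm₁ := sum_range_mono_of_nonneg hterm hsup₁
  have hm₂ := sum_range_mono_of_nonneg hterm hsup₂
  have hS0 : 0 ≤ ∑ j ∈ Finset.range N, Real.log ((j : ℝ) + 2) * w j := Finset.sum_nonneg fun j _ ↦ hterm j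
  rw [hsplit, hsum₂]
  calc _ ≤ 2 * C * ∑ j ∈ Finset.range (F₁.sup windowIndex + 1), Real.log ((j : ℝ) + 2) * w j +
        2 * C * ∑ j ∈ Finset.range (G₂.sup windowIndex + 1), Real.log ((j : ℝ) + 2) * w j :=
        add_le_add h₁ h₂
    _ ≤ 2 * C * ∑ j ∈ Finset.range N, Real.log ((j : ℝ) + 2) * w j +
        2 * C * ∑ j ∈ Finset.range N, Real.log ((j : ℝ) + 2) * w j := by
        gcongr
    _ = 4 * C * ∑ j ∈ Finset.range N, Real.log ((j : ℝ) + 2) * w j := by ring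

/-- **The upper law with exponent `B` from a window-indexed bound at the zeros** (PROVED).  If for every
window `a ≥ 1` there is a test `k` supported in `[−a, a]`, `‖k‖₂ > 0`, and a non-negative weight `w` with
`‖k̂(ρ)‖² ≤ w(j(ρ))` at every non-trivial zero and ALL partial sums
`Σ_{j<N} log(j+2) w(j) ≤ D · μ^B e^{-4πμ} · ‖k‖₂²` (`D` uniform in `a`), then `ConnesLawUpperWith B`. -/
theorem connesLawUpperWith_of_windowBound {D B : ℝ}
    (h : ∀ a : ℝ, 1 ≤ a → ∃ (k : ℝ → ℂ) (w : ℕ → ℝ), IsWeilTest k ∧ tsupport k ⊆ Icc (-a) a ∧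
      0 < ∫ t : ℝ, ‖k t‖ ^ 2 ∧ (∀ j, 0 ≤ w j) ∧
      (∀ ρ ∈ ZetaZeros.riemannZetaNontrivialZeros, ‖weilMellin k ρ‖ ^ 2 ≤ w (windowIndex ρ)) ∧
      ∀ N : ℕ, ∑ j ∈ Finset.range N, Real.log ((j : ℝ) + 2) * w j ≤
        D * Real.exp (2 * a) ^ B * Real.exp (-(4 * Real.pi * Real.exp (2 * a))) * ∫ t : ℝ, ‖k t‖ ^ 2) :
    ConnesLawUpperWith B := by
  classical
  obtain ⟨C, hC0, hC⟩ := exists_windowCount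
  refine connesLawUpperWith_of_zeroSums (C := C * D) (B := B) fun a ha ↦ ?_
  obtain ⟨k, w, hk, hs, hpos, hw, hρ, hsum⟩ := h a ha
  refine ⟨k, hk, hs, hpos, fun T ↦ ?_⟩
  rw [finsum_weilZeroIndex_eq_sum (fun ρ ↦ (riemannZetaZeroOrder ρ : ℝ) * ‖weilMellin k ρ‖ ^ 2)]
  set F : Finset ℂ := (weilZeroFinset T).map (Function.Embedding.subtype _) with hFdef
  have hF : ∀ ρ ∈ F, ρ ∈ ZetaZeros.riemannZetaNontrivialZeros := fun ρ hρ ↦ by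
    rw [hFdef, Finset.mem_map] at hρ
    obtain ⟨z, -, rfl⟩ := hρ
    exact z.2
  have e : ∑ ρ ∈ weilZeroFinset T, (riemannZetaZeroOrder (ρ : ℂ) : ℝ) * ‖weilMellin k ρ‖ ^ 2 =
      ∑ ρ ∈ F, (riemannZetaZeroOrder ρ : ℝ) * ‖weilMellin k ρ‖ ^ 2 := by
    rw [hFdef, Finset.sum_map]; rfl
  rw [e]
  have hX : 0 ≤ Real.exp (2 * a) ^ B * Real.exp (-(4 * Real.pi * Real.exp (2 * a))) * ∫ t : ℝ, ‖k t‖ ^ 2 :=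
    mul_nonneg (mul_nonneg (Real.rpow_nonneg (Real.exp_pos _).le _) (Real.exp_pos _).le) hpos.le
  calc ∑ ρ ∈ F, (riemannZetaZeroOrder ρ : ℝ) * ‖weilMellin k ρ‖ ^ 2
      ≤ ∑ ρ ∈ F, (riemannZetaZeroOrder ρ : ℝ) * w (windowIndex ρ) := by
        refine Finset.sum_le_sum fun ρ hρ' ↦ ?_
        exact mul_le_mul_of_nonneg_left (hρ ρ (hF ρ hρ'))
          (riemannZetaZeroOrder_nonneg_of_zero (ZetaZeros.riemannZetaNontrivialZeros.zeta_eq_zero (hF ρ hρ')))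
    _ ≤ C * ∑ j ∈ Finset.range (F.sup windowIndex + 1), Real.log ((j : ℝ) + 2) * w j := hC w hw F hF
    _ ≤ C * (D * Real.exp (2 * a) ^ B * Real.exp (-(4 * Real.pi * Real.exp (2 * a))) * ∫ t : ℝ, ‖k t‖ ^ 2) :=
        mul_le_mul_of_nonneg_left (hsum _) hC0.le
    _ = C * D * Real.exp (2 * a) ^ B * Real.exp (-(4 * Real.pi * Real.exp (2 * a))) * ∫ t : ℝ, ‖k t‖ ^ 2 := by
        ring

/-! ## §C The abscissae of the zeros: `c₀ / log(|γ| + 4) ≤ Re ρ ≤ 1 − c₀ / log(|γ| + 4)` -/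

/-- **De la Vallée-Poussin at the zeros, both sides** (PROVED from the tree's
`classicalZFRData_riemannZeta.zeroFree` and the symmetry `ρ ↦ 1 − ρ̄` of the non-trivial zeros):
`∃ c₀ > 0, ∀ ρ` non-trivial zero, `c₀ / log(|Im ρ| + 4) ≤ Re ρ` and `c₀ / log(|Im ρ| + 4) ≤ 1 − Re ρ`. -/
theorem exists_div_log_le_re :
    ∃ c₀ : ℝ, 0 < c₀ ∧ ∀ ρ ∈ ZetaZeros.riemannZetaNontrivialZeros,
      c₀ / Real.log (|ρ.im| + 4) ≤ ρ.re ∧ c₀ / Real.log (|ρ.im| + 4) ≤ 1 - ρ.re := by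
  obtain ⟨c, hc0, hc⟩ := classicalZFRData_riemannZeta.zeroFree
  have hlog4 : 0 < Real.log 4 := Real.log_pos (by norm_num)
  refine ⟨min c (Real.log 4 / 2), lt_min hc0 (by positivity), fun ρ hρ ↦ ?_⟩
  have hL : Real.log 4 ≤ Real.log (|ρ.im| + 4) :=
    Real.log_le_log (by norm_num) (by linarith [abs_nonneg ρ.im])
  have hL0 : 0 < Real.log (|ρ.im| + 4) := hlog4.trans_le hL
  -- the generic half: `Re ρ ≥ 1/2 ⇒` trivial; `Re ρ < 1/2 ⇒` apply the region to `1 − ρ̄`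
  have key : ∀ z ∈ ZetaZeros.riemannZetaNontrivialZeros,
      min c (Real.log 4 / 2) / Real.log (|z.im| + 4) ≤ z.re := by
    intro z hz
    have hLz : Real.log 4 ≤ Real.log (|z.im| + 4) :=
      Real.log_le_log (by norm_num) (by linarith [abs_nonneg z.im])
    have hLz0 : 0 < Real.log (|z.im| + 4) := hlog4.trans_le hLz
    rcases le_or_gt (1 / 2 : ℝ) z.re with hz2 | hz2
    · calc min c (Real.log 4 / 2) / Real.log (|z.im| + 4) ≤ (Real.log 4 / 2) / Real.log 4 :=
            div_le_div₀ (by positivity) (min_le_right _ _) hlog4 hLz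
        _ = 1 / 2 := by field_simp
        _ ≤ z.re := hz2
    · -- `s = 1 − z̄` is a zero of `ζ₁` with `Re s > 1/2`
      set s : ℂ := 1 - conj z with hs
      have hsmem := ZetaZeros.riemannZetaNontrivialZeros.one_sub_conj_mem hz
      have hsζ : riemannZeta s = 0 := ZetaZeros.riemannZetaNontrivialZeros.zeta_eq_zero hsmem
      have hs1 : s ≠ 1 := ZetaZeros.riemannZetaNontrivialZeros.ne_one hsmem
      have hsζ₁ : riemannZeta₁ s = 0 := (riemannZeta₁_eq_zero_iff hs1).2 hsζ
      have hsre : s.re = 1 - z.re := by simp [hs]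
      have hsim : s.im = z.im := by simp [hs]
      have hdom : 1 - 1 / 2 < s.re := by rw [hsre]; linarith
      have hnot : ¬ (1 - c / Real.log (|s.im| + 4) < s.re) := fun h ↦ hc s hdom h hsζ₁
      rw [not_lt, hsre, hsim] at hnot
      have : c / Real.log (|z.im| + 4) ≤ z.re := by linarith
      exact le_trans (div_le_div_of_nonneg_right (min_le_left _ _) hLz0.le) this
  refine ⟨key ρ hρ, ?_⟩
  have h := key (1 - conj ρ) (ZetaZeros.riemannZetaNontrivialZeros.one_sub_conj_mem hρ)
  simp only [sub_re, one_re, conj_re, sub_im, one_im, conj_im, zero_sub, abs_neg] at h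
  exact h

end Summit.RiemannHypothesis.RiemannHypothesis.Theorems.PfPersistenceM2Leak
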